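import Summits.QuantumFields.QCD.Theses.HeatSlicedQuarks

/-!
# `RobustYangMillsHandover` — the chirality obstruction to heavy-threshold handovers
# (negative lane; statement re-type p117723; definition-free)

Crux `stmt-QuantumFields-8892` of route `HeatSlicedQuarks` is the bare arrow
`RobustYangMillsHandover := ContinuumQCDExists → QCD`.  Since the summit re-type of 2026-08-16
(`QCDOf N_f` conjoins `reg.IsChiralAtZero`: for every `ε > 0` some POSITIVE mass tuple of the SAME
regularisation has no uniform lattice gap `ε`) the former head of every line on this crux — the
threshold reading `QCDOf N_f ↔ ∃ M₀ ≥ 0, ∃ reg, … ∀ m > M₀ …`, proved by shifting the flavour-blind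
critical mass `m_crit(k) ↦ m_crit(k) + a_k M₀ / Z_m(k)` — is no longer a theorem.  This file records,
kernel-checked against the CURRENT statement and importing only the route module (nothing downstream
of the pre-re-type `QCDOf` body), the facts that kill that head and constrain every re-ideation:

* `hasLatticeMassGap_species_irrel` — the lattice gap clause reads only `(β_k, L_k, a_k, m_f(k))`,
  so it is decided by `(reg, m)`; the species renormalisations `z, shift` are idle (definitional).
* `isChiralAtZero_or_uniformLatticeGap`, `not_isChiralAtZero_iff_uniformLatticeGap` — EXCLUDED MIDDLE
  on chirality: a regularisation is either chiral at zero, or uniformly gapped on the lattice at EVERY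
  positive mass tuple with ONE rate `ε > 0`.
* `hasMassScaling_mcrit_shift_iff`, `isChiralAtZero_mcrit_shift_iff` — the `m_crit`-shifted
  regularisation realises at masses `m` the scheme of `reg` at `M₀ + m` (tree: `scheme_mcrit_shift`), keeps
  `HasMassScaling`, and is chiral at zero iff `reg` has gapless-at-every-rate points just ABOVE `M₀`.
* `not_isChiralAtZero_of_uniformGapAbove` (relational form) and
  `not_isChiralAtZero_mcrit_shift_of_uniformGapAbove` — **the obstruction**: if `reg` is uniformly
  gapped above a threshold `M₀`, then every regularisation whose positive-mass schemes are `reg`'s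
  schemes at `M₀ + m` (in particular the `m_crit`-shift, the only regularisation a heavy-threshold
  handover can name for the conjunct) is PROVABLY NOT chiral at zero.  A heavy-quark handover with a
  uniform gap therefore refutes the chirality of its own output; with a non-uniform gap it merely fails
  to entail it.
* `qcdOf_gap_profile`, `qcdOf_imp_aboveThreshold` — what the re-typed conjunct asks of ONE
  regularisation (gapped at every positive tuple AND no uniform rate: the light-quark regime is inside),
  and the surviving direction of the old threshold reading.

Adapted from the crux workfiles `Cruxes/RobustYangMillsHandover/RetypeDichotomyC3.lean` (lead c3),
`RetypeImpact.lean` (lead c2) and `StuckGoalC4.lean` (lead c4); landed def-free by lead a1 so that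
planners, ideators and future skeletons can import it instead of the stale
`GluonicCompletion.Negative.Threshold` / `Negative.GapClauses` modules.  Pure logic over the tree's
definitions; nothing here asserts a Theses decl.
-/

namespace Summit.QuantumFields.QCD.Theorems.RobustYangMillsHandover.Negative

open Summit.QuantumFields.QCD.Theses.HeatSlicedQuarks
open Literature.MathematicalPhysics.QuantumFieldTheory
open Filter

variable {Nf : ℕ}

/-! ## The lattice gap clause is decided by `(reg, m)` -/

/-- `HasLatticeMassGap` reads only `β, L, a, mq` of the scheme, so the species renormalisations
`z, shift` are idle: the clause at `reg.scheme m z shift` is the clause at `reg.scheme m 0 0`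
(definitional). [folklore] -/
theorem hasLatticeMassGap_species_irrel (reg : QCDRegularisation Nf) (m : Fin Nf → ℝ)
    (z shift : QCDField Nf → ℕ → ℝ) (Δ : ℝ) :
    (reg.scheme m z shift).HasLatticeMassGap Δ ↔ (reg.scheme m 0 0).HasLatticeMassGap Δ :=
  Iff.rfl

/-! ## Excluded middle on chirality -/

/-- **Chirality dichotomy.** Every regularisation is either chiral at zero, or uniformly gapped on the
lattice at EVERY positive mass tuple with ONE rate `ε > 0` (for all species renormalisations).
[folklore] -/
theorem isChiralAtZero_or_uniformLatticeGap (reg : QCDRegularisation Nf) :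
    reg.IsChiralAtZero ∨
      ∃ ε > (0 : ℝ), ∀ m : Fin Nf → ℝ, (∀ f, 0 < m f) →
        ∀ z shift : QCDField Nf → ℕ → ℝ, (reg.scheme m z shift).HasLatticeMassGap ε := by
  by_cases h : reg.IsChiralAtZero
  · exact Or.inl h
  · refine Or.inr ?_
    unfold QCDRegularisation.IsChiralAtZero at h
    push Not at h
    obtain ⟨ε, hε, h⟩ := h
    exact ⟨ε, hε, fun m hm z shift => (hasLatticeMassGap_species_irrel reg m z shift ε).mpr (h m hm)⟩

/-- A uniform lattice gap at all positive mass tuples refutes chirality at zero. [folklore] -/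
theorem not_isChiralAtZero_of_uniformLatticeGap (reg : QCDRegularisation Nf) {ε : ℝ} (hε : 0 < ε)
    (h : ∀ m : Fin Nf → ℝ, (∀ f, 0 < m f) → (reg.scheme m 0 0).HasLatticeMassGap ε) :
    ¬ reg.IsChiralAtZero := by
  intro hχ
  obtain ⟨m, hm, hng⟩ := hχ ε hε
  exact hng (h m hm)

/-- Non-chirality IS a uniform lattice gap at every positive mass tuple (the dichotomy as an `iff`).
[folklore] -/
theorem not_isChiralAtZero_iff_uniformLatticeGap (reg : QCDRegularisation Nf) :
    ¬ reg.IsChiralAtZero ↔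
      ∃ ε > (0 : ℝ), ∀ m : Fin Nf → ℝ, (∀ f, 0 < m f) → (reg.scheme m 0 0).HasLatticeMassGap ε := by
  constructor
  · intro h
    rcases isChiralAtZero_or_uniformLatticeGap reg with hχ | ⟨ε, hε, hgap⟩
    · exact absurd hχ h
    · exact ⟨ε, hε, fun m hm => hgap m hm 0 0⟩
  · rintro ⟨ε, hε, hgap⟩
    exact not_isChiralAtZero_of_uniformLatticeGap reg hε hgap

/-! ## The `m_crit` shift and chirality -/

/-- The shift does not touch `HasMassScaling` (which never reads `m_crit`). [folklore] -/
theorem hasMassScaling_mcrit_shift_iff (reg : QCDRegularisation Nf) (M₀ : ℝ) :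
    ({ reg with mcrit := fun k => reg.mcrit k + reg.a k * M₀ / reg.Zm k } : QCDRegularisation Nf).HasMassScaling
      ↔ reg.HasMassScaling :=
  Iff.rfl

/-- Chirality of the shifted regularisation, unfolded: it asks for gapless-at-every-rate points of the
ORIGINAL regularisation at positive masses above `M₀` — light-quark content relative to the unshifted
offset, which no heavy-threshold mechanism supplies. This is the common stuck goal of every line on the
crux after the re-type. [folklore] -/
theorem isChiralAtZero_mcrit_shift_iff (reg : QCDRegularisation Nf) (M₀ : ℝ) :
    ({ reg with mcrit := fun k => reg.mcrit k + reg.a k * M₀ / reg.Zm k } : QCDRegularisation Nf).IsChiralAtZero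
      ↔ ∀ ε > (0 : ℝ), ∃ m : Fin Nf → ℝ, (∀ f, 0 < m f) ∧
          ¬ (reg.scheme (fun f => M₀ + m f) 0 0).HasLatticeMassGap ε := by
  -- the shifted scheme at `m` is the original scheme at `M₀ + m` (the tree's
  -- `GluonicCompletion.Negative.scheme_mcrit_shift`, re-derived inline to avoid importing that module)
  have hs : ∀ (m : Fin Nf → ℝ) (z shift : QCDField Nf → ℕ → ℝ),
      ({ reg with mcrit := fun k => reg.mcrit k + reg.a k * M₀ / reg.Zm k } : QCDRegularisation Nf).scheme
        m z shift = reg.scheme (fun f => M₀ + m f) z shift := by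
    intro m z shift
    simp only [QCDRegularisation.scheme, QCDScheme.mk.injEq, true_and, and_true]
    funext f k
    ring
  unfold QCDRegularisation.IsChiralAtZero
  simp only [hs]

/-- **The chirality obstruction (relational form).** If `reg` is uniformly gapped (rate `ε`) at every
tuple with all masses `> M₀`, then ANY regularisation `reg'` whose schemes at positive masses `m` are
`reg`'s schemes at `M₀ + m` is NOT chiral at zero. [folklore] -/
theorem not_isChiralAtZero_of_uniformGapAbove (reg reg' : QCDRegularisation Nf) (M₀ : ℝ) {ε : ℝ}
    (hε : 0 < ε)
    (hrel : ∀ m : Fin Nf → ℝ, (∀ f, 0 < m f) → reg'.scheme m 0 0 = reg.scheme (fun f => M₀ + m f) 0 0)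
    (h : ∀ m : Fin Nf → ℝ, (∀ f, M₀ < m f) → (reg.scheme m 0 0).HasLatticeMassGap ε) :
    ¬ reg'.IsChiralAtZero := by
  refine not_isChiralAtZero_of_uniformLatticeGap reg' hε fun m hm => ?_
  rw [hrel m hm]
  exact h _ fun f => by linarith [hm f]

/-- **The chirality obstruction for the `m_crit` shift** — the only regularisation a heavy-threshold
handover can name for the conjunct: a uniform lattice gap above the threshold `M₀` REFUTES the
chirality of the shifted regularisation. Hence threshold data with a uniform gap can never witness the
re-typed `QCDOf` through the shift (the former head `qcdOf_iff_threshold.mpr`). [folklore] -/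
theorem not_isChiralAtZero_mcrit_shift_of_uniformGapAbove (reg : QCDRegularisation Nf) (M₀ : ℝ)
    {ε : ℝ} (hε : 0 < ε)
    (h : ∀ m : Fin Nf → ℝ, (∀ f, M₀ < m f) → (reg.scheme m 0 0).HasLatticeMassGap ε) :
    ¬ ({ reg with mcrit := fun k => reg.mcrit k + reg.a k * M₀ / reg.Zm k } :
        QCDRegularisation Nf).IsChiralAtZero := by
  rw [isChiralAtZero_mcrit_shift_iff]
  intro hχ
  obtain ⟨m, hm, hng⟩ := hχ ε hε
  exact hng (h _ fun f => by linarith [hm f])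

/-! ## What the re-typed conjunct asks of ONE regularisation -/

/-- **Gap profile forced by the re-typed conjunct**: one regularisation with mass scaling that is chiral
at zero, gapped on the lattice at EVERY positive mass tuple, and WITHOUT a uniform rate (for every
`ε > 0` some positive tuple is not `ε`-gapped) — in particular it is not in the non-chiral branch of
`isChiralAtZero_or_uniformLatticeGap`: the light-quark regime is inside the conjunct. [folklore] -/
theorem qcdOf_gap_profile (h : QCDOf Nf) :
    ∃ reg : QCDRegularisation Nf, reg.HasMassScaling ∧ reg.IsChiralAtZero ∧
      (∀ m : Fin Nf → ℝ, (∀ f, 0 < m f) → ∃ Δ > 0, (reg.scheme m 0 0).HasLatticeMassGap Δ) ∧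
      ¬ ∃ ε > (0 : ℝ), ∀ m : Fin Nf → ℝ, (∀ f, 0 < m f) → (reg.scheme m 0 0).HasLatticeMassGap ε := by
  obtain ⟨reg, hMS, hχ, hall⟩ := h
  refine ⟨reg, hMS, hχ, fun m hm => ?_, ?_⟩
  · obtain ⟨z, shift, T, -, -, -, -, Δ, hΔ, -, hL⟩ := hall m hm
    exact ⟨Δ, hΔ, (hasLatticeMassGap_species_irrel reg m z shift Δ).mp hL⟩
  · rintro ⟨ε, hε, hgap⟩
    exact not_isChiralAtZero_of_uniformLatticeGap reg hε hgap hχ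

/-- **The surviving direction of the threshold reading**: the re-typed conjunct still implies its
pre-re-type threshold form (honest data and both gap clauses above an offset `M₀ ≥ 0`, here `M₀ = 0`);
the converse — the former head of every heavy-threshold line — is what the re-type removed. [folklore] -/
theorem qcdOf_imp_aboveThreshold (h : QCDOf Nf) :
    ∃ M₀ : ℝ, 0 ≤ M₀ ∧ ∃ reg : QCDRegularisation Nf, reg.HasMassScaling ∧
      ∀ m : Fin Nf → ℝ, (∀ f, M₀ < m f) →
        ∃ (z shift : QCDField Nf → ℕ → ℝ) (T : OSData (QCDField Nf) 4),
          IsQCDAlong (reg.scheme m z shift) T ∧ T.IsNontrivial QCDField.glue ∧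
            T.IsNonGaussian QCDField.glue ∧
              (∀ f g : Fin Nf, f ≠ g → T.IsNontrivial (QCDField.pseudoRe f g)) ∧
                ∃ Δ > 0, T.HasMassGap Δ ∧ (reg.scheme m z shift).HasLatticeMassGap Δ := by
  obtain ⟨reg, hMS, -, hall⟩ := h
  exact ⟨0, le_rfl, reg, hMS, hall⟩

/-- **The crux, read through the obstruction.** `RobustYangMillsHandover` unfolds to
`ContinuumQCDExists → QCDOf 2 ∧ QCDOf 3`; by `qcdOf_gap_profile` any proof must exhibit, from X₀'s
regularisation (offset unpinned, no gap data), a CHIRAL-pinned regularisation gapped at all positive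
masses — so it cannot end with the `m_crit` shift of a uniformly-gapped-above-threshold regularisation
(`not_isChiralAtZero_mcrit_shift_of_uniformGapAbove`). Recorded as the definitional unfolding.
[folklore] -/
theorem robustYangMillsHandover_iff_perFlavour :
    RobustYangMillsHandover ↔ (ContinuumQCDExists → QCDOf 2 ∧ QCDOf 3) :=
  Iff.rfl

end Summit.QuantumFields.QCD.Theorems.RobustYangMillsHandover.Negative
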